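import Summits.Ventures.HodgeKum4.Theorems.KummerFixedLocusFrameComplement
import HarnessLib

/-!
# Route KummerFixedLocus (`hodge-kum4`, rung H3) — L1: the frame complement from the route's OWN print-input items

Seat p1.  The support child `FrameComplementKum4` of L1 is closed here from the two ITEM-STATED print
inputs of the route, F_Γ = `Kum4TranslationGroup` (`|Γ(X)| = 625 ∧ dim 𝒦 ≤ 624`; only `|Γ(X)| = 625`
is used) and F_Γ′ = `Kum4TranslationGroupTrivialOffMiddle` (`Γ(X)` acts trivially on `Hᵏ`, `k ≠ 8`),
instead of the Literature cite constants `Floccari2026_card_autFixingH2H3_kum4Type` /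
`Foster2024_translationAction_kum4Type` used by `frameComplementKum4_of_literature`
(file `KummerFixedLocusFrameComplement`) — bookkeeping asked by the planner (g7, 2026-08-26T05:11Z) and
endorsed by director-hodge so that no Literature cite constant sits inside an ITEM statement:

* `IsKummerTranslationFrame.toAut_surjective_of_card` — a Kummer translation frame `(ℤ/5)⁴ → Γ(X)`
  exhausts `Γ(X)` as soon as `|Γ(X)| = 625`; hence `frameInvariants_eq_gammaInvariantClasses_of_card`:
  `H*(X(ℂ); ℂ)^{frame} = H*(X(ℂ); ℂ)^{Γ(X)}`;
* `cup_eq_zero_of_mem_coinvariantsKer_of_offMiddle` — `H² ∪ 𝒦 = 0` using ONLY the degree-`10`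
  triviality of `Γ(X)` (F_Γ′), and `totalLefschetz_apply_of_mem_of_offMiddle` — every `L_x` kills `𝒦_tot`;
* **`frameComplementKum4_of_translationGroup : Kum4TranslationGroup → Kum4TranslationGroupTrivialOffMiddle
  → FrameComplementKum4`** — `N' := 𝒦_tot` (seat p2's `coinvariantsKerTotal`) is a complement by
  `isCompl_gammaInvariantClasses_coinvariantsKerTotal` (Maschke in degree `8`, F_Γ′ elsewhere; finiteness
  of `Γ(X)` from F_Γ via `gammaFinite_of_translationGroup`), killed by `h` (`degreeOperator_apply_of_mem`)
  and by every `L_x`.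

HONEST FRAMING: a kernel theorem with the route's print inputs F_Γ, F_Γ′ as hypotheses; nothing here says
`HC_Kum4Type` is proved.
-/

noncomputable section

open CategoryTheory
open Literature.AlgebraicTopology.SingularHomology
open Literature.AlgebraicGeometry Literature.AlgebraicGeometry.HodgeTheory
open Literature.AlgebraicGeometry.Hyperkaehler (IsOfGeneralizedKummerType totalCohomology ofDegree
  degreeOperator totalLefschetz totalLefschetz_lof invariantClasses mem_invariantClasses_iff
  translationRep translationRep_apply)
open Literature.Geometry.Kaehler (lefschetzOperator_apply)

namespace Summit.Ventures.HodgeKum4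

variable {X : Motives.SchemeOver ℂ} {g : (Fin 4 → ZMod 5) → (X ⟶ X)}

/-- A Kummer translation frame EXHAUSTS `Γ(X)` as soon as `|Γ(X)| = 625` (a faithful action of a group of
order `625` on a group of order `625`). -/
theorem IsKummerTranslationFrame.toAut_surjective_of_card (hcard : Nat.card (autFixingH2H3 X) = 625)
    (hg : IsKummerTranslationFrame X g) :
    Function.Surjective fun a ↦ (⟨hg.toAut a, hg.toAut_mem a⟩ : autFixingH2H3 X) := by
  haveI : Finite (autFixingH2H3 X) := Nat.finite_of_card_ne_zero (by rw [hcard]; norm_num)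
  have hdom : Nat.card (Fin 4 → ZMod 5) = 625 := by
    rw [Nat.card_eq_fintype_card]; simp
  exact (Function.Injective.bijective_of_nat_card_le hg.toAut_injective
    (by rw [hcard, hdom])).surjective

/-- **`H*(X(ℂ); ℂ)^{frame} = H*(X(ℂ); ℂ)^{Γ(X)}`** for a Kummer translation frame, granted `|Γ(X)| = 625`. -/
theorem frameInvariants_eq_gammaInvariantClasses_of_card (hcard : Nat.card (autFixingH2H3 X) = 625)
    (hg : IsKummerTranslationFrame X g) :
    frameInvariants X g = gammaInvariantClasses X := by
  apply le_antisymm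
  · intro v hv
    rw [frameInvariants, mem_invariantClasses_iff] at hv
    rw [gammaInvariantClasses, mem_invariantClasses_iff]
    rintro _ ⟨γ, rfl⟩
    obtain ⟨a, rfl⟩ := hg.toAut_surjective_of_card hcard γ
    exact hv _ ⟨a, rfl⟩
  · intro v hv
    rw [gammaInvariantClasses, mem_invariantClasses_iff] at hv
    rw [frameInvariants, mem_invariantClasses_iff]
    rintro _ ⟨a, rfl⟩
    exact hv _ ⟨⟨hg.toAut a, hg.toAut_mem a⟩, rfl⟩

/-- **`H² ∪ 𝒦 = 0` from F_Γ′ alone**: every class of the augmentation submodule `𝒦 ⊂ H⁸(X(ℂ); ℂ)` is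
killed by cup product with `H²(X(ℂ); ℂ)`, granted only that `Γ(X)` acts trivially on `H¹⁰(X(ℂ); ℂ)`
(`Kum4TranslationGroupTrivialOffMiddle` in the target degree `l = 10 ≠ 8`). -/
theorem cup_eq_zero_of_mem_coinvariantsKer_of_offMiddle (hoff : Kum4TranslationGroupTrivialOffMiddle)
    (hX : Motives.IsSmoothProjective 8 X) (hK : IsOfGeneralizedKummerType 4 X)
    {l : ℕ} (h : 2 + 8 = l) (e : complexBetti X 2) {x : complexBetti X 8}
    (hx : x ∈ Representation.Coinvariants.ker (translationRep X 8)) :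
    cupProduct (R := ℂ) (X := Motives.ComplexPoints X) h e x = 0 := by
  unfold Representation.Coinvariants.ker at hx
  induction hx using Submodule.span_induction with
  | mem y hy =>
    obtain ⟨⟨γ, v⟩, rfl⟩ := hy
    change cupProduct h e (translationRep X 8 γ v - v) = 0
    rw [map_sub, cup_translationRep, sub_eq_zero]
    have hl : l ≠ 8 := by omega
    rw [hoff hX hK l hl _ (γ⁻¹).2]
    rfl
  | zero => exact map_zero _
  | add a b _ _ ha hb => rw [map_add, ha, hb, add_zero]
  | smul c a _ ha => rw [map_smul, ha, smul_zero]

/-- Every Lefschetz operator kills `𝒦_tot`, granted F_Γ′ (`H² ∪ 𝒦 = 0`). -/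
theorem totalLefschetz_apply_of_mem_of_offMiddle (hoff : Kum4TranslationGroupTrivialOffMiddle)
    (hX : Motives.IsSmoothProjective 8 X) (hK : IsOfGeneralizedKummerType 4 X)
    (a : complexBetti X 2) {w : totalCohomology ℂ (Motives.ComplexPoints X)}
    (hw : w ∈ coinvariantsKerTotal X) : totalLefschetz a w = 0 := by
  obtain ⟨y, hy, rfl⟩ := hw
  rw [totalLefschetz_lof, lefschetzOperator_apply,
    cup_eq_zero_of_mem_coinvariantsKer_of_offMiddle hoff hX hK (Nat.add_comm 2 8) a hy, map_zero]

/-- **The frame complement from the route's print-input items F_Γ and F_Γ′** (`N' = 𝒦_tot`): for `X`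
smooth projective of `Kum⁴`-type with a Kummer translation frame `g`, the `g`-invariant classes
(`= H*(X(ℂ); ℂ)^{Γ(X)}` since `|Γ(X)| = 625`) have the complement `𝒦_tot`, killed by the degree
operator and by every Lefschetz operator `L_x`, `x ∈ H²(X(ℂ); ℂ)`. -/
theorem frameComplementKum4_of_translationGroup (hΓ : Kum4TranslationGroup)
    (hoff : Kum4TranslationGroupTrivialOffMiddle) : FrameComplementKum4 := by
  intro X g hX hK hg
  refine ⟨coinvariantsKerTotal X, ?_, fun n hn ↦ degreeOperator_apply_of_mem hn,
    fun x n hn ↦ totalLefschetz_apply_of_mem_of_offMiddle hoff hX hK x hn⟩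
  rw [frameInvariants_eq_gammaInvariantClasses_of_card (hΓ hX hK).1 hg]
  exact isCompl_gammaInvariantClasses_coinvariantsKerTotal (gammaFinite_of_translationGroup hΓ) hoff hX hK

end Summit.Ventures.HodgeKum4

end
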